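import Summits.QuantumAdvantage.QuantumAdvantage.Theorems.FlatDialMCert

/-!
# FlatDialLCert — module 10 of the lens-3 g11 «FlatDial» THEOREMS package (cell decomp-qadv): the framed cube-key MM function HAS a valid `M`-certificate

Module 9 says every valid `M`-certificate of `y ↦ cubeMM r (A y)` spans `L = A⁻¹{z = 0}`; this module EXHIBITS one (record §12 (c), the `msub` field of
`FlatDial.MRecovery` up to the table representation of the planted function):

* §1 ★ `map_comb` : an ADDITIVE functional `φ` commutes with row combinations — `φ (comb c a) = ⟨a, (φ rowₖ)ₖ⟩` (support induction); corollaries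
  `comb_injective_of_dual` (rows with a dual family of additive functionals are independent) and `map_comb_eq_false`;
* §2 the certificate `lCert A` (offset `0`, slope `0`, rows `A⁻¹(e_j, 0)`), `cubeMM_eq_bd` / `cubeMM_of_z` (the function vanishes on `{z = 0}`), and
  ★★ `lCert_mem_validMCerts (hA) : lCert A ∈ validMCerts fun y => cubeMM r (A y)`, hence `cubeMM_frame_mem_hasMSub : (fun y => cubeMM r (A y)) ∈ hasMSub _`.

ZERO `def X : Prop`.  Provenance: HOME/decomp-qadv-lens-3/g11/ (record NODE-g11.md §12, LAND-g11.md step 10).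
-/

set_option linter.dupNamespace false

namespace Summit.QuantumAdvantage.QuantumAdvantage.Theorems.FlatDial

open Finset
open Literature.Computability.QuantumComplexity
open Literature.Computability.QuantumComplexity.BuzetChailloux (bxor zeroVec bxor_self bxor_zeroVec zeroVec_bxor bxor_bxor_cancel_left)
open Summit.QuantumAdvantage.QuantumAdvantage.Theorems.HintDial.Automaton (bd sgl bd_sgl_left bd_sgl_right bd_bxor_right)

/-! ## 1. Additive functionals commute with row combinations -/

section Generic

variable {n : ℕ}

/-- an additive functional vanishes at `0`. -/
theorem map_zeroVec_of_add {φ : (Fin n → Bool) → Bool} (hφ : ∀ x y, φ (bxor x y) = xor (φ x) (φ y)) : φ zeroVec = false := by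
  have h := hφ zeroVec zeroVec
  rw [bxor_self] at h
  revert h; cases φ zeroVec <;> decide

/-- ★ an ADDITIVE functional commutes with row combinations: `φ (Σₖ aₖ rowₖ) = Σₖ aₖ φ(rowₖ)`. -/
theorem map_comb {φ : (Fin n → Bool) → Bool} (hφ : ∀ x y, φ (bxor x y) = xor (φ x) (φ y)) (c : CertIdx n → Bool)
    (a : Fin (n / 2) → Bool) : φ (comb c a) = bd a fun k => φ (certRow c k) := by
  classical
  suffices H : ∀ (s : Finset (Fin (n / 2))) (a : Fin (n / 2) → Bool), (∀ k, a k = true → k ∈ s) →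
      φ (comb c a) = bd a fun k => φ (certRow c k) from H univ a fun k _ => mem_univ k
  intro s
  induction s using Finset.induction_on with
  | empty =>
    intro a ha
    have h0 : a = zeroVec := funext fun k => by
      cases hk : a k
      · rfl
      · exact absurd (ha k hk) (Finset.notMem_empty k)
    rw [h0, comb_zeroVec, map_zeroVec_of_add hφ, bd_zeroVec_left]
  | insert k s hks ih =>
    intro a ha
    cases hk : a k
    · refine ih a fun j hj => ?_
      have hj' := ha j hj
      rw [mem_insert] at hj'
      rcases hj' with rfl | h
      · rw [hk] at hj; exact absurd hj Bool.false_ne_true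
      · exact h
    · have e : a = bxor (bxor a (sgl k)) (sgl k) := by
        funext j; show a j = xor (xor (a j) (sgl k j)) (sgl k j); cases a j <;> cases sgl k j <;> rfl
      have ha' : ∀ j, bxor a (sgl k) j = true → j ∈ s := by
        intro j hj
        change xor (a j) (decide (j = k)) = true at hj
        by_cases hjk : j = k
        · subst hjk; rw [hk, decide_eq_true rfl] at hj; exact absurd hj (by decide)
        · rw [decide_eq_false hjk, Bool.xor_false] at hj
          have hj' := ha j hj
          rw [mem_insert] at hj'
          exact hj'.resolve_left hjk
      conv_lhs => rw [e, comb_bxor, hφ, ih _ ha', comb_sgl, bd_bxor_left, bd_sgl_left]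
      generalize bd a (fun k => φ (certRow c k)) = P
      generalize φ (certRow c k) = Q
      cases P <;> cases Q <;> rfl

/-- rows admitting a DUAL family of additive functionals are independent. -/
theorem comb_injective_of_dual (c : CertIdx n → Bool) (φ : Fin (n / 2) → (Fin n → Bool) → Bool)
    (hφ : ∀ k x y, φ k (bxor x y) = xor (φ k x) (φ k y)) (hδ : ∀ k j, φ k (certRow c j) = decide (j = k)) :
    Function.Injective (comb c) := by
  intro a a' h
  funext k
  have e := congrArg (φ k) h
  rw [map_comb (hφ k), map_comb (hφ k)] at e
  have hs : (fun j => φ k (certRow c j)) = sgl k := funext fun j => hδ k j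
  rwa [hs, bd_sgl_right, bd_sgl_right] at e

/-- an additive functional vanishing on the rows vanishes on the span. -/
theorem map_comb_eq_false {φ : (Fin n → Bool) → Bool} (hφ : ∀ x y, φ (bxor x y) = xor (φ x) (φ y)) (c : CertIdx n → Bool)
    (h : ∀ k, φ (certRow c k) = false) (a : Fin (n / 2) → Bool) : φ (comb c a) = false := by
  rw [map_comb hφ, show (fun k => φ (certRow c k)) = zeroVec from funext h, bd_comm, bd_zeroVec_left]

end Generic

/-! ## 2. The `L`-certificate of a framed cube-key MM function -/

section Framed

variable {r : ℕ}

/-- `cubeMM` is the dot product of the `x`-half against the cube key of the `z`-half. -/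
theorem cubeMM_eq_bd (y : Fin (r * 3 + r * 3) → Bool) :
    cubeMM r y = bd (fun j => y (Fin.castAdd (r * 3) j)) (cubeKey fun i => y (Fin.natAdd (r * 3) i)) := by
  rw [cubeMM, mmFun, Bool.xor_false]

/-- the cube key fixes `0`. -/
theorem cubeKey_zeroVec : cubeKey (zeroVec : Fin (r * 3) → Bool) = zeroVec := by
  rw [cubeKey, show (fun j => q (blk (zeroVec : Fin (r * 3) → Bool) j)) = fun _ => (0 : LemmaU.B) from
    funext fun j => by rw [blk_zeroVec]; decide, unblk_zero]

/-- ★ `cubeMM` vanishes on `{z = 0}`. -/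
theorem cubeMM_of_z {y : Fin (r * 3 + r * 3) → Bool} (hy : ∀ i, y (Fin.natAdd (r * 3) i) = false) : cubeMM r y = false := by
  rw [cubeMM_eq_bd, show (fun i => y (Fin.natAdd (r * 3) i)) = zeroVec from funext hy, cubeKey_zeroVec, bd_comm, bd_zeroVec_left]

/-- an additive bijection fixes `0`. -/
theorem frame_zeroVec {A : Equiv.Perm (Fin (r * 3 + r * 3) → Bool)} (hA : ∀ x y, A (bxor x y) = bxor (A x) (A y)) :
    A zeroVec = zeroVec := by
  have h := hA zeroVec zeroVec
  rw [bxor_self, bxor_self] at h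
  exact h

/-- the unit vector `(e_j, 0)` of the `x`-half. -/
def xunit (j : Fin (r * 3)) : Fin (r * 3 + r * 3) → Bool := Fin.append (sgl j) zeroVec

/-- `(r*3 + r*3)/2 = r*3`, as a cast of row indices. -/
theorem half_rows (r : ℕ) : (r * 3 + r * 3) / 2 = r * 3 := by omega

/-- ★ THE `L`-CERTIFICATE of the framed function: offset `t = 0`, slope `x* = 0`, rows `A⁻¹(e_j, 0)`. -/
def lCert (A : Equiv.Perm (Fin (r * 3 + r * 3) → Bool)) : CertIdx (r * 3 + r * 3) → Bool :=
  Sum.elim (fun _ => false) (Sum.elim (fun ki => A.symm (xunit (Fin.cast (half_rows r) ki.1)) ki.2) fun _ => false)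

variable (A : Equiv.Perm (Fin (r * 3 + r * 3) → Bool))

/-- its offset is `0`. -/
theorem certT_lCert : certT (lCert A) = zeroVec := rfl

/-- its slope is `0`. -/
theorem certXs_lCert : certXs (lCert A) = zeroVec := rfl

/-- its rows. -/
theorem certRow_lCert (k : Fin ((r * 3 + r * 3) / 2)) : certRow (lCert A) k = A.symm (xunit (Fin.cast (half_rows r) k)) := rfl

variable {A}

/-- the frame maps every row combination into `{z = 0}`. -/
theorem frame_comb_lCert_z (hA : ∀ x y, A (bxor x y) = bxor (A x) (A y)) (a : Fin ((r * 3 + r * 3) / 2) → Bool)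
    (i : Fin (r * 3)) : A (comb (lCert A) a) (Fin.natAdd (r * 3) i) = false := by
  refine map_comb_eq_false (φ := fun y => A y (Fin.natAdd (r * 3) i)) (fun x y => by rw [hA]) (lCert A) (fun k => ?_) a
  show A (certRow (lCert A) k) (Fin.natAdd (r * 3) i) = false
  rw [certRow_lCert, Equiv.apply_symm_apply, xunit, Fin.append_right]
  rfl

/-- the frame reads the coefficients off the `x`-half of a row combination. -/
theorem frame_comb_lCert_x (hA : ∀ x y, A (bxor x y) = bxor (A x) (A y)) (a : Fin ((r * 3 + r * 3) / 2) → Bool)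
    (k : Fin ((r * 3 + r * 3) / 2)) : A (comb (lCert A) a) (Fin.castAdd (r * 3) (Fin.cast (half_rows r) k)) = a k := by
  have h := map_comb (φ := fun y => A y (Fin.castAdd (r * 3) (Fin.cast (half_rows r) k))) (fun x y => by rw [hA]) (lCert A) a
  have hs : (fun j => A (certRow (lCert A) j) (Fin.castAdd (r * 3) (Fin.cast (half_rows r) k))) = sgl k := by
    funext j
    rw [certRow_lCert, Equiv.apply_symm_apply, xunit, Fin.append_left]
    show decide (Fin.cast (half_rows r) k = Fin.cast (half_rows r) j) = decide (j = k)
    by_cases hjk : j = k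
    · subst hjk; simp
    · rw [decide_eq_false (fun e => hjk (Fin.cast_injective _ e).symm), decide_eq_false hjk]
  change A (comb (lCert A) a) (Fin.castAdd (r * 3) (Fin.cast (half_rows r) k)) = _ at h ⊢
  rw [h, hs, bd_sgl_right]

/-- ★ the rows of `lCert A` are independent. -/
theorem comb_lCert_injective (hA : ∀ x y, A (bxor x y) = bxor (A x) (A y)) : Function.Injective (comb (lCert A)) := by
  intro a a' h
  funext k
  rw [← frame_comb_lCert_x hA a k, ← frame_comb_lCert_x hA a' k, h]

/-- ★★ `lCert A` IS A VALID `M`-CERTIFICATE of the framed function. -/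
theorem lCert_mem_validMCerts (hA : ∀ x y, A (bxor x y) = bxor (A x) (A y)) :
    lCert A ∈ validMCerts fun y => cubeMM r (A y) := by
  have hz : ∀ a, cubeMM r (A (comb (lCert A) a)) = false := fun a => cubeMM_of_z (frame_comb_lCert_z hA a)
  refine ⟨⟨comb_lCert_injective hA, fun a => ?_⟩, fun a b y => ?_⟩
  · change cubeMM r (A (bxor (certT (lCert A)) (comb (lCert A) a)))
        = xor (cubeMM r (A (certT (lCert A)))) (bd (certXs (lCert A)) (comb (lCert A) a))
    rw [certT_lCert, certXs_lCert, zeroVec_bxor, bd_zeroVec_left, hz, frame_zeroVec hA, Bool.xor_false]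
    exact (cubeMM_of_z fun _ => rfl).symm
  · -- all four points share the `z`-half of `A y`; the `x`-halves differ by span elements, and `cubeMM` is linear in `x`
    have hu := frame_comb_lCert_z hA a
    have hv := frame_comb_lCert_z hA b
    simp only [hA, cubeMM_eq_bd]
    have ez : ∀ w : Fin (r * 3 + r * 3) → Bool, (∀ i, w (Fin.natAdd (r * 3) i) = false) →
        ∀ y' : Fin (r * 3 + r * 3) → Bool, (fun i => bxor y' w (Fin.natAdd (r * 3) i)) = fun i => y' (Fin.natAdd (r * 3) i) := by
      intro w hw y'; funext i; show xor (y' _) (w _) = y' _; rw [hw, Bool.xor_false]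
    have ex : ∀ w y' : Fin (r * 3 + r * 3) → Bool,
        (fun j => bxor y' w (Fin.castAdd (r * 3) j)) = bxor (fun j => y' (Fin.castAdd (r * 3) j)) fun j => w (Fin.castAdd (r * 3) j) :=
      fun w y' => rfl
    simp only [ez _ hv, ez _ hu, ex, bd_bxor_left]
    generalize (cubeKey fun i => A y (Fin.natAdd (r * 3) i)) = K
    generalize bd (fun j => A y (Fin.castAdd (r * 3) j)) K = p
    generalize bd (fun j => A (comb (lCert A) a) (Fin.castAdd (r * 3) j)) K = q'
    generalize bd (fun j => A (comb (lCert A) b) (Fin.castAdd (r * 3) j)) K = s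
    cases p <;> cases q' <;> cases s <;> rfl

/-- hence the framed cube-key MM function lies in `MM#` (has an `M`-certificate). -/
theorem cubeMM_frame_mem_hasMSub (hA : ∀ x y, A (bxor x y) = bxor (A x) (A y)) :
    (fun y => cubeMM r (A y)) ∈ hasMSub (r * 3 + r * 3) :=
  ⟨lCert A, lCert_mem_validMCerts hA⟩

end Framed

end Summit.QuantumAdvantage.QuantumAdvantage.Theorems.FlatDial
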